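import Summits.CriticalPhenomena.PercolationContinuityZ3.Theorems.PercNearOneGluingNoHeavyLowerTailConditionalGZ
import HarnessLib

/-!
# `NoHeavyLowerTail` (crux stmt-CriticalPhenomena-4575), law-level frontier: the conditional Gladkov–Zimin theorem at the level of the
# percolation measure (endpoint of the sampler-free proof route `LsmTwoCopy` → `SetSourceBHK` → `ConditionalGZ`)

Support file (prover seat `prim-bnk-1` gen 14; `--supports stmt-CriticalPhenomena-4575`; no computation, no new definition).

`cgz_prodBernoulli`: for `μ = prodBernoulli w` on a finite vertex type, terminals `T`, any vertex set `Y`, any MONOTONE LABEL `π` of edge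
sets into a preorder (read on the union `⋃_{t∈T} C_t` of the open edge clusters of the terminals) and any Gladkov–Zimin kernel `A`
(`A a d + A b c ≤ A a c + A b d` for `a ≤ b`, `c ≤ d`):  `∫_D ∫_D A(ℓω, ℓω') dμ dμ ≤ μ(D) · ∫_D A(ℓω, ℓω) dμ`,  `D = {T ↮ Y}`.

PRIOR RESULTS IN THE TREE (this file does not claim novelty of the statement): the conditional Gladkov–Zimin theorem is Gladkov–Zimin
draft 2024, §3.2 / Cor. 3.4–3.5; for connection-PATTERN labels it is `Literature.Probability.Percolation.CondGZ.prodBernoulli_condPatternKernel_le`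
(seat prim-l12-p1, via the van den Berg–Häggström–Kahn Gibbs sampler), and its three-terminal instance (the spectator-triangle row `F11y`) is
`CutVertexMinors.condAG_isolatedSet_lab` / `SpectatorTriangleRow.spectatorTriangle_all`.  What this route adds: (i) a sampler-free proof
(BHK's first-layer decomposition + BHK Thm 1.1 with a source set + the two-copy inequality for LOG-SUPERMODULAR weights
`LsmTwoCopy.lsm_twoCopy_le` + induction on the vertex set), (ii) labels may be ANY monotone function of the terminal clusters' edge union
(so `A = f ⊗ g` recovers BHK Thm 1.3 for arbitrary increasing cluster functions, not only pattern functions).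
Memo: run/shared/lean/prim/prim-l12/FROM-prim-bnk-1-gen14-CONDITIONAL-GZ-PROVED.md (with the correction in its header).
-/

namespace Summit.CriticalPhenomena.PercolationContinuityZ3.Theorems.ConditionalGZ

open Finset MeasureTheory Literature.Probability.Percolation Literature.Probability.Percolation.BHK2006
open Literature.Probability.Percolation.DecisionTree (ind ind_of_mem ind_of_not_mem ind_nonneg)
open Literature.Probability.LatticeModels (prodBernoulli)
open SetSourceBHK
open scoped Classical

variable {V : Type*} [Fintype V] [DecidableEq V]

/-- **Conditional Gladkov–Zimin theorem, measure form** (Gladkov–Zimin draft 2024 §3.2 / Cor. 3.4–3.5; here via the sampler-free route of this seat).  For `μ = prodBernoulli w` on a finite vertex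
type, terminals `T`, any vertex set `Y`, a monotone label `π` of edge sets into a preorder and a Gladkov–Zimin kernel `A`
(`A a d + A b c ≤ A a c + A b d` for `a ≤ b`, `c ≤ d`), with `D = {T ↮ Y}` and `ℓ ω = π(⋃_{t∈T} C_t(ω))` the label of the
clusters of the terminals:  `∫_D ∫_D A(ℓω, ℓω') dμ(ω') dμ(ω) ≤ μ(D) · ∫_D A(ℓω, ℓω) dμ(ω)`.
(`Y = ∅`: Gladkov–Zimin Thm. 2.3 for connection patterns; `A = f ⊗ g`: BHK Thm. 1.3.) [this work] -/
theorem cgz_prodBernoulli (w : Sym2 V → unitInterval) (T : Finset V) (Y : Set V)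
    {κ : Type*} [Preorder κ] (π : Set (Sym2 V) → κ) (hπ : Monotone π) (A : κ → κ → ℝ)
    (hA : ∀ a b c d : κ, a ≤ b → c ≤ d → A a d + A b c ≤ A a c + A b d) :
    ∫ ω in {ω : BondConfig V | ∀ t ∈ T, ∀ y ∈ Y, ¬ (openGraph ω).Reachable t y},
      (∫ ω' in {ω : BondConfig V | ∀ t ∈ T, ∀ y ∈ Y, ¬ (openGraph ω).Reachable t y},
        A (π (⋃ t ∈ T, openEdgeCluster ω t)) (π (⋃ t ∈ T, openEdgeCluster ω' t)) ∂(prodBernoulli w))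
      ∂(prodBernoulli w) ≤
    (prodBernoulli w).real {ω : BondConfig V | ∀ t ∈ T, ∀ y ∈ Y, ¬ (openGraph ω).Reachable t y} *
      ∫ ω in {ω : BondConfig V | ∀ t ∈ T, ∀ y ∈ Y, ¬ (openGraph ω).Reachable t y},
        A (π (⋃ t ∈ T, openEdgeCluster ω t)) (π (⋃ t ∈ T, openEdgeCluster ω t)) ∂(prodBernoulli w) := by
  set μ := prodBernoulli w with hμ
  set D : Set (BondConfig V) := {ω | ∀ t ∈ T, ∀ y ∈ Y, ¬ (openGraph ω).Reachable t y} with hD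
  have hDm : MeasurableSet D := MeasurableSet.of_discrete
  set w' : Sym2 V → ℝ := fun e => (w e : ℝ) with hw'
  have hw0 : ∀ e, 0 ≤ w' e := fun e => (w e).2.1
  have hw1 : ∀ e, w' e ≤ 1 := fun e => (w e).2.2
  have hint : ∀ h : Set (Sym2 V) → ℝ, ∫ ω in D, h ω ∂μ = ∑ ω, weight w' ω * (h ω * ind D ω) := by
    intro h
    rw [← integral_indicator hDm, integral_prodBernoulli_eq_sum]
    refine Finset.sum_congr rfl fun ω _ => ?_
    by_cases hω : ω ∈ D
    · rw [Set.indicator_of_mem hω, ind_of_mem hω, mul_one]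
    · rw [Set.indicator_of_notMem hω, ind_of_not_mem hω]; ring
  have hreal : μ.real D = ∑ ω, weight w' ω * ind D ω := by
    rw [← integral_indicator_one hDm, integral_prodBernoulli_eq_sum]
    refine Finset.sum_congr rfl fun ω _ => ?_
    by_cases hω : ω ∈ D
    · rw [Set.indicator_of_mem hω, ind_of_mem hω, Pi.one_apply]
    · rw [Set.indicator_of_notMem hω, ind_of_not_mem hω, mul_zero]
  have hm : ∑ ω, weight w' ω = 1 := by
    have h1 := integral_prodBernoulli_eq_sum w fun _ => (1 : ℝ)
    simp only [integral_const, probReal_univ, smul_eq_mul, mul_one] at h1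
    exact h1.symm
  have hE : ∀ ω : Set (Sym2 V), ω ∩ edgesIn (Finset.univ : Finset V) = ω := fun ω => by
    ext e
    simp only [Set.mem_inter_iff, edgesIn, Set.mem_setOf_eq, Finset.mem_univ, imp_true_iff, and_true]
  have hclu : ∀ ω : Set (Sym2 V), (⋃ t ∈ T, rC Finset.univ t ω) = ⋃ t ∈ T, openEdgeCluster ω t := fun ω => by
    simp only [rC, hE]
  have hDD : {ω : Set (Sym2 V) | ∀ t ∈ T, ω ∈ rD Finset.univ t Y} = D := by
    ext ω; simp only [rD, hE, hD, Set.mem_setOf_eq]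
  have key := cgzCore w' hw0 hw1 hm π hπ A hA Finset.univ T (Finset.subset_univ T) Y (by simp)
  simp only [hclu, hDD] at key
  simp only [hint]
  rw [hreal]
  calc ∑ ω, weight w' ω * ((∑ ω', weight w' ω' * (A (π (⋃ t ∈ T, openEdgeCluster ω t))
          (π (⋃ t ∈ T, openEdgeCluster ω' t)) * ind D ω')) * ind D ω)
      = ∑ ω, ∑ ω', weight w' ω * weight w' ω' * (A (π (⋃ t ∈ T, openEdgeCluster ω t))
          (π (⋃ t ∈ T, openEdgeCluster ω' t)) * ind D ω * ind D ω') := by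
        refine Finset.sum_congr rfl fun ω _ => ?_
        rw [Finset.sum_mul, Finset.mul_sum]
        exact Finset.sum_congr rfl fun ω' _ => by ring
    _ ≤ _ := key

end Summit.CriticalPhenomena.PercolationContinuityZ3.Theorems.ConditionalGZ
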